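import Mathlib.Geometry.Manifold.Instances.Sphere
import Mathlib.Geometry.Manifold.Diffeomorph
import Mathlib.Geometry.Manifold.IsManifold.Basic
import Mathlib.Geometry.Manifold.ContMDiffMap
import Mathlib.Analysis.Calculus.IteratedDeriv.Defs
import Mathlib.AlgebraicTopology.FundamentalGroupoid.SimplyConnected
import Mathlib.Geometry.Manifold.SmoothEmbedding
import HarnessLib

/-!
# Huisken–Sinestrari: a closed simply connected two-convex embedded hypersurface of `ℝⁿ⁺¹`,
# `n ≥ 3`, is diffeomorphic to `Sⁿ` (Invent. Math. 175 (2009), Cor. 1.3)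

Topic `Literature/Geometry/Riemannian`; for route `SmoothPoincare4/ConvexityLadder`, rung (a)
(`CvxTwoConvexStandard`, n = 4).

Source: G. Huisken, C. Sinestrari, *Mean curvature flow with surgeries of two-convex
hypersurfaces*, Invent. Math. 175 (2009) 137–221 [HuiskenSinestrari2008] (held text
`paper:doi-10-1007-s00222-008-0148-4`, pp. 138–139), verbatim: "A surface is called two-convex if
the sum of the two smallest principal curvatures `λ₁ + λ₂` is nonnegative everywhere.
**Theorem 1.1** Let `F₀ : M → ℝⁿ⁺¹` be a smooth immersion of a closed `n`-dimensional hypersurface,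
with `n ≥ 3`. Suppose that `M₀ = F₀(M)` is two-convex, i.e. that `λ₁ + λ₂ ≥ 0` everywhere on `M₀`.
Then there exists a mean curvature flow with surgeries starting from `M₀` which terminates after a
finite number of steps. … **Corollary 1.2** Any smooth closed `n`-dimensional two-convex immersed
surface `F₀ : M → ℝⁿ⁺¹` with `n ≥ 3` is diffeomorphic either to `Sⁿ` or to a finite connected sum
of `Sⁿ⁻¹ × S¹`. … **Corollary 1.3** Any smooth closed simply connected `n`-dimensional two-convex
embedded surface `M ⊂ ℝⁿ⁺¹` with `n ≥ 3` is diffeomorphic to `Sⁿ` and bounds a region whose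
closure is diffeomorphic to a smoothly embedded `(n+1)`-dimensional standard closed ball."

## What is vendored

`HuiskenSinestrari2009_twoConvex_simplyConnected` — the first clause of **Corollary 1.3**
(`M ≅ Sⁿ`), in the level-set idiom of the route file (no second fundamental form in Mathlib):
the embedded hypersurface is `e(M) = {F = 0}` for a smooth `F : ℝⁿ⁺¹ → ℝ` with `∇F ≠ 0` on
`{F = 0}` and `{F ≤ 0}` compact (so `∇F/|∇F|` is the OUTWARD unit normal and the second
fundamental form of the level set is `Hess F|_{T} / |∇F|`, `T = ker dF`); two-convexity
`λ₁ + λ₂ ≥ 0` is `Hess F(v₁,v₁) + Hess F(v₂,v₂) ≥ 0` for every orthonormal pair `v₁, v₂ ∈ T`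
(Ky Fan: the minimum over orthonormal pairs of the trace on a `2`-plane is `λ₁ + λ₂`); for the
round sphere `F = |x|² − 1` it holds. `M` is a smooth boundaryless (`𝓡 n`-modelled) compact simply
connected manifold and `e` a smooth embedding (`Manifold.IsSmoothEmbedding`).

Deliberately NOT here: Theorem 1.1 itself (no mean curvature flow with surgery in the tree),
Corollary 1.2 (connected sums of `Sⁿ⁻¹ × S¹` have no Mathlib carrier), the second clause of
Cor. 1.3 (the bounded region is a standard ball), immersed (non-embedded) surfaces, and the
Riemannian-ambient version of Brendle–Huisken (arXiv:1507.04651).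
-/

noncomputable section

open scoped Manifold ContDiff

namespace Literature.Geometry.Riemannian

/-- **Huisken–Sinestrari 2009, Corollary 1.3 (first clause).** A smooth closed simply connected
two-convex embedded hypersurface `Mⁿ ⊂ ℝⁿ⁺¹`, `n ≥ 3`, is diffeomorphic to `Sⁿ`. Level-set
rendering: `e(M) = {F = 0}`, `∇F ≠ 0` there, `{F ≤ 0}` compact, and
`Hess F(v₁,v₁) + Hess F(v₂,v₂) ≥ 0` for all orthonormal tangent pairs (`λ₁ + λ₂ ≥ 0` for the
outward normal). [cite: HuiskenSinestrari2008, Corollary 1.3] -/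
def HuiskenSinestrari2009_twoConvex_simplyConnected : Prop :=
  ∀ (n : ℕ), 3 ≤ n →
  ∀ (M : Type) [TopologicalSpace M] [T2Space M] [SecondCountableTopology M] [CompactSpace M]
    [ChartedSpace (EuclideanSpace ℝ (Fin n)) M] [IsManifold (𝓡 n) ∞ M],
    SimplyConnectedSpace M →
  ∀ (F : EuclideanSpace ℝ (Fin (n + 1)) → ℝ) (e : M → EuclideanSpace ℝ (Fin (n + 1))),
    ContDiff ℝ ∞ F → IsCompact {x | F x ≤ 0} → (∀ x, F x = 0 → fderiv ℝ F x ≠ 0) →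
    Manifold.IsSmoothEmbedding (𝓡 n) 𝓘(ℝ, EuclideanSpace ℝ (Fin (n + 1))) ∞ e →
    Set.range e = {x | F x = 0} →
    (∀ x, F x = 0 → ∀ v : Fin 2 → EuclideanSpace ℝ (Fin (n + 1)), Orthonormal ℝ v →
      (∀ i, fderiv ℝ F x (v i) = 0) → 0 ≤ ∑ i, iteratedFDeriv ℝ 2 F x ![v i, v i]) →
    Nonempty (M ≃ₘ⟮𝓡 n, 𝓡 n⟯ Metric.sphere (0 : EuclideanSpace ℝ (Fin (n + 1))) 1)

end Literature.Geometry.Riemannian
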